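import Summits.CriticalPhenomena.PercolationContinuityZ3.Theorems.Transplant.FKDoubleFanOneSidedDominance
import Summits.CriticalPhenomena.PercolationContinuityZ3.Theorems.Transplant.FKDoubleFanOneSidedRays
import Summits.CriticalPhenomena.PercolationContinuityZ3.Theorems.Transplant.FKDoubleFanMultifanGens
import Summits.CriticalPhenomena.PercolationContinuityZ3.Theorems.Transplant.FKDoubleFanMultifanGood
import HarnessLib

/-!
# Double fans, ONE-SIDED DOMINANCE: the closure statements (CL-a), (CL-b) reduce to ENDPOINT inputs (degenerate frame, floor points, roof points)

Helper file (`--supports stmt-CriticalPhenomena-4575`), FK sub-lane `prim-bschramm-fk-3` (gen 37); builds on p205010 (kernel theorem, internal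
audit signed; external expert review pending).  Pure real algebra, no sorries; standard axioms.  Memo `bschramm/prim-bschramm-fk-3/FAR-CROSS-XII.md` §2.

By `…OneSidedDominance` the far cross-apex pair for EVERY middle word follows from the two closure statements `HypA q` (an `a`-spoke after a
`b`-gadget image of an `a`-pinned input stays in the one-sided cone `osCone q`) and `HypB q`.  Both quantify over ALL rests `w ∈ InKE q`.
This file removes that quantifier: the one-sided images `imgA q F w`, `imgB q G w` are LINEAR in the input bivector `w ∧ (AC_1 ∗ w)`, and along the
apex-`b` fibre `w = vecB q W y X Z u₀` the pinned vector `AC_1 ∗ w` does not see `u₀` (`conv_edgeAC_one_vecB` of `…MultifanGens`), so for every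
`γ` the functionals `w ↦ ⟪A_x · imgB q G w, γ⟫`, `w ↦ ⟪B_y · imgA q F w, γ⟫` are AFFINE along the fibre (**`imgB_ufibre`**, **`imgA_ufibre`**).
The generic floor/roof method `nonneg_of_rays_gen` of `…OneSidedRays` (masses `≥ 0` and `(U_b)`, both consequences of `InKE`) therefore gives
(**`hypA_of_endpoints`**, **`hypB_of_endpoints`**, `0 < q < 1`): `HypA q` (resp. `HypB q`) holds as soon as the membership
`opAC x (imgB q G v) ∈ osCone q` (resp. `opBC y (imgA q F v) ∈ osCone q`) holds for the three ENDPOINT families of inputs only —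
the degenerate frame `v = vecB q (qy) y 0 0 u₀` (`0 ≤ u₀ ≤ y`), the floor points `v = vecB q W y X Z 0` (`X, Z, y ≥ 0`, `qy < W`, `Z₁ ≥ 0`) and
the roof points `v = roofV q κ l t w` (`κ ≥ 0`, `l > 0`, `t ≥ 0`, `w ∈ [0,1]`).  At `q = 1` both statements are trivial (**`hypA_one`**, **`hypB_one`**:
the pairing `pairH 1` vanishes identically).  Together with `negCorr_spokes_cross_far_of_dominance` this is the input-side half of the finite
reduction of the far programme for general middles (memo §2: the gadget side `G`, `F` is quadratic along its fibre and needs the cone-Bernstein form).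
[folklore]
-/

noncomputable section

namespace Summit.CriticalPhenomena.PercolationContinuityZ3.Theorems

namespace FK

namespace ThreeApex

/-! ### The one-sided images are affine along the input fibre -/

/-- `AC_0 = δ₀` acts trivially: the unpinned member of the input pair is the rest itself. [folklore] -/
theorem conv_edgeAC_zero_vecB (q W y X Z u0 : ℝ) : conv (edgeAC 0) (vecB q W y X Z u0) = vecB q W y X Z u0 :=
  conv_edgeAC_zero _

/-- **The `b`-image is affine along the `u₀`-fibre** (`w = vecB q W y X Z u₀`, `u₀ ↦ c·a + (1−c)·b`). [folklore] -/
theorem imgB_ufibre (q : ℝ) (G : V5) (W y X Z a b c : ℝ) :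
    imgB q G (vecB q W y X Z (c * a + (1 - c) * b)) =
      Biv.lin3 c (imgB q G (vecB q W y X Z a)) (1 - c) (imgB q G (vecB q W y X Z b)) 0 (wedgeH G G) := by
  ext <;> simp only [imgB, wedgeH, fanComboB, conv, edgeAC, edgeBC, detach, vecB, V5.total, hx, hy, hz, Biv.lin3, Biv.add, Biv.smul] <;> ring

/-- **The `a`-image is affine along the `u₀`-fibre.** [folklore] -/
theorem imgA_ufibre (q : ℝ) (F : V5) (W y X Z a b c : ℝ) :
    imgA q F (vecB q W y X Z (c * a + (1 - c) * b)) =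
      Biv.lin3 c (imgA q F (vecB q W y X Z a)) (1 - c) (imgA q F (vecB q W y X Z b)) 0 (wedgeH F F) := by
  ext <;> simp only [imgA, wedgeH, fanCombo, conv, edgeAC, detach, vecB, V5.total, hx, hy, hz, Biv.lin3, Biv.add, Biv.smul] <;> ring

/-- `opAC` is linear: it passes through `Biv.lin3`. [folklore] -/
theorem opAC_lin3 (x a b c : ℝ) (β γ δ : Biv) :
    opAC x (Biv.lin3 a β b γ c δ) = Biv.lin3 a (opAC x β) b (opAC x γ) c (opAC x δ) := by
  ext <;> simp only [opAC, opTa, opWa, Biv.lin3, Biv.add, Biv.smul] <;> ring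

/-- `opBC` is linear: it passes through `Biv.lin3`. [folklore] -/
theorem opBC_lin3 (y a b c : ℝ) (β γ δ : Biv) :
    opBC y (Biv.lin3 a β b γ c δ) = Biv.lin3 a (opBC y β) b (opBC y γ) c (opBC y δ) := by
  ext <;> simp only [opBC, opTb, opWb, Biv.lin3, Biv.add, Biv.smul] <;> ring

/-- The pairing against a `lin3`. [folklore] -/
theorem pairH_lin3_left (q a b c : ℝ) (β γ δ ε : Biv) :
    pairH q (Biv.lin3 a β b γ c δ) ε = a * pairH q β ε + b * pairH q γ ε + c * pairH q δ ε := by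
  simp only [Biv.lin3, pairH_add_left, pairH_smul_left]; ring

/-- The functional `w ↦ ⟪A_x · imgB q G w, γ⟫` is affine along the `u₀`-fibre. [folklore] -/
theorem pairH_opAC_imgB_affine (q x : ℝ) (G : V5) (γ : Biv) (W y X Z a b c : ℝ) :
    pairH q (opAC x (imgB q G (vecB q W y X Z (c * a + (1 - c) * b)))) γ =
      c * pairH q (opAC x (imgB q G (vecB q W y X Z a))) γ + (1 - c) * pairH q (opAC x (imgB q G (vecB q W y X Z b))) γ := by
  rw [imgB_ufibre, opAC_lin3, pairH_lin3_left]; ring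

/-- The functional `w ↦ ⟪B_y · imgA q F w, γ⟫` is affine along the `u₀`-fibre. [folklore] -/
theorem pairH_opBC_imgA_affine (q y' : ℝ) (F : V5) (γ : Biv) (W y X Z a b c : ℝ) :
    pairH q (opBC y' (imgA q F (vecB q W y X Z (c * a + (1 - c) * b)))) γ =
      c * pairH q (opBC y' (imgA q F (vecB q W y X Z a))) γ + (1 - c) * pairH q (opBC y' (imgA q F (vecB q W y X Z b))) γ := by
  rw [imgA_ufibre, opBC_lin3, pairH_lin3_left]; ring

/-! ### (CL-a) and (CL-b) from the endpoint inputs -/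

/-- **(CL-a) from the endpoint inputs** (`0 < q < 1`): if `A_x · imgB q G v ∈ osCone q` for every `b`-gadget `G ∈ InKE q`, every `x ∈ [0,1]` and
every ENDPOINT input `v` — degenerate frame, floor point, roof point of the apex-`b` frame — then `HypA q`. [folklore] -/
theorem hypA_of_endpoints {q : ℝ} (hq0 : 0 < q) (hq1 : q < 1)
    (hdeg : ∀ (G : V5) (x y u0 : ℝ), InKE q G → 0 ≤ x → x ≤ 1 → 0 ≤ u0 → u0 ≤ y →
      opAC x (imgB q G (vecB q (q * y) y 0 0 u0)) ∈ osCone q)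
    (hfloor : ∀ (G : V5) (x W y X Z : ℝ), InKE q G → 0 ≤ x → x ≤ 1 → 0 ≤ X → 0 ≤ Z → 0 ≤ y → q * y < W → 0 ≤ W - q * y - X - Z →
      opAC x (imgB q G (vecB q W y X Z 0)) ∈ osCone q)
    (hroof : ∀ (G : V5) (x κ l t w : ℝ), InKE q G → 0 ≤ x → x ≤ 1 → 0 ≤ κ → 0 < l → 0 ≤ t → 0 ≤ w → w ≤ 1 →
      opAC x (imgB q G (roofV q κ l t w)) ∈ osCone q) :
    HypA q := by
  intro G w x hG hw hx0 hx1 γ hγ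
  have hwN : w.Nonneg := (hw.valid hq0.le hq1.le).nonneg
  have hwU : UCond q (swapAB w) := hw.uCondB hq0 hq1.le
  exact nonneg_of_rays_gen hq0 hq1 (Φ := fun v => pairH q (opAC x (imgB q G v)) γ)
    (fun W y X Z a b c => pairH_opAC_imgB_affine q x G γ W y X Z a b c)
    (fun y u0 hu0 hu0y => hdeg G x y u0 hG hx0 hx1 hu0 hu0y γ hγ)
    (fun W y X Z hX hZ hy hW h1 => hfloor G x W y X Z hG hx0 hx1 hX hZ hy hW h1 γ hγ)
    (fun κ l t w' hκ hl ht hw0 hw1 => hroof G x κ l t w' hG hx0 hx1 hκ hl ht hw0 hw1 γ hγ) hwN hwU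

/-- **(CL-b) from the endpoint inputs** (`0 < q < 1`). [folklore] -/
theorem hypB_of_endpoints {q : ℝ} (hq0 : 0 < q) (hq1 : q < 1)
    (hdeg : ∀ (F : V5) (y' y u0 : ℝ), InKE q F → 0 ≤ y' → y' ≤ 1 → 0 ≤ u0 → u0 ≤ y →
      opBC y' (imgA q F (vecB q (q * y) y 0 0 u0)) ∈ osCone q)
    (hfloor : ∀ (F : V5) (y' W y X Z : ℝ), InKE q F → 0 ≤ y' → y' ≤ 1 → 0 ≤ X → 0 ≤ Z → 0 ≤ y → q * y < W → 0 ≤ W - q * y - X - Z →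
      opBC y' (imgA q F (vecB q W y X Z 0)) ∈ osCone q)
    (hroof : ∀ (F : V5) (y' κ l t w : ℝ), InKE q F → 0 ≤ y' → y' ≤ 1 → 0 ≤ κ → 0 < l → 0 ≤ t → 0 ≤ w → w ≤ 1 →
      opBC y' (imgA q F (roofV q κ l t w)) ∈ osCone q) :
    HypB q := by
  intro F w y' hF hw hy0 hy1 γ hγ
  have hwN : w.Nonneg := (hw.valid hq0.le hq1.le).nonneg
  have hwU : UCond q (swapAB w) := hw.uCondB hq0 hq1.le
  exact nonneg_of_rays_gen hq0 hq1 (Φ := fun v => pairH q (opBC y' (imgA q F v)) γ)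
    (fun W y X Z a b c => pairH_opBC_imgA_affine q y' F γ W y X Z a b c)
    (fun y u0 hu0 hu0y => hdeg F y' y u0 hF hy0 hy1 hu0 hu0y γ hγ)
    (fun W y X Z hX hZ hy hW h1 => hfloor F y' W y X Z hF hy0 hy1 hX hZ hy hW h1 γ hγ)
    (fun κ l t w' hκ hl ht hw0 hw1 => hroof F y' κ l t w' hF hy0 hy1 hκ hl ht hw0 hw1 γ hγ) hwN hwU

/-! ### The trivial case `q = 1` -/

/-- At `q = 1` every bivector lies in the one-sided cone (the pairing `pairH 1` vanishes, `pairH_one` of `…MultifanGood`). [folklore] -/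
theorem mem_osCone_one (β : Biv) : β ∈ osCone 1 :=
  fun γ _ => (pairH_one β γ).symm.le

/-- `HypA 1` holds trivially. [folklore] -/
theorem hypA_one : HypA 1 := fun _ _ _ _ _ _ _ => mem_osCone_one _

/-- `HypB 1` holds trivially. [folklore] -/
theorem hypB_one : HypB 1 := fun _ _ _ _ _ _ _ => mem_osCone_one _

end ThreeApex

end FK

end Summit.CriticalPhenomena.PercolationContinuityZ3.Theorems
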